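import Mathlib
import HarnessLib

/-!
# Kummer's condition for free, II: a `q`-SATURATED independent system of generators satisfies the
# Kummer condition in exponent form (Baker–Stark / Nesterenko's Corollary 4.5 / Yu's saturated lattice)

Topic `NumberTheory/DiophantineGeometry`; namespace
`Literature.NumberTheory.DiophantineGeometry.KummerSaturated`. Companion of
`PadicLogFormsKummerFree.lean` (which treats the generators `±∏ qⱼ^{λⱼ}` built from rational PRIMES):
here the generators are ARBITRARY — elements `θ₁, …, θ_r` of a commutative group, resp. non-zero
elements of a field (`ℚ` in the applications) — and the hypothesis is the one the printed reduction
step actually delivers: the system is multiplicatively independent and the group it generates is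
**`q`-saturated up to `q`-th roots of unity** (every `g` with `g^q ∈ ⟨θ⟩` satisfies `ε g ∈ ⟨θ⟩` for
some `ε` with `ε^q = 1`). CONCLUSION (the Kummer condition in the exponent form consumed by the
tree's descent steps, e.g. `Literature.NumberTheory.Transcendental.CW77.descent_algebra`'s `hind` and
the `3`-Kummer hypothesis `(∃ j, ¬ 3 ∣ κ j) → ∀ γ, ∏ αⱼ^{κ j} ≠ γ³` of the cell abc-stewartyu's
`2`-adic engines): **if `∏ θᵢ^{κᵢ} = g^q` then `q ∣ κᵢ` for every `i`**; for `q = 2`: no non-empty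
sub-product of the `θᵢ` is a square.

This is the algebraic content of the "lattice saturation" device by which the printed proofs
REMOVE the Kummer hypothesis at no cost in the heights over `ℚ`:
* Yu. V. Nesterenko, *Linear forms in logarithms of rational numbers* (LNM 1819, 2003), §4.3,
  Lemma 4.4 (Baker–Stark over `ℚ`: `√β ∈ ℚ(√β₁,…,√β_m) ⇒ β = β₁^{i₁}⋯β_m^{i_m} γ²`) and
  **Corollary 4.5**: for a basis `ū₁,…,ūₙ` of the lattice `𝔑 = {λ ∈ ℚⁿ : α^λ ∈ ℚ}` and
  `log θᵢ = Σⱼ u_{ij} log αⱼ`, `deg ℚ(√θ₁,…,√θₙ) = 2ⁿ` ((4.48); held text, chunks p0122–p0123 of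
  `book:editornd-diophantine-approximation`, read by the filing seat);
* K. Yu, *p-adic logarithmic forms and a problem of Erdős*, Acta Math. 211 (2013), §1.1 p. 319: the
  `q`-saturated lattice `M = 𝓜_K(α₁,…,αₙ) ∩ (ℤ[1/q])ⁿ` (Loher–Masser lattice
  `𝓜_K = {(s₁/t,…,sₙ/t) : αᵢ^{sᵢ}⋯ ∈ K^t}`), a basis `b₁,…,bₙ`, units `ϑ₁,…,ϑₙ`, "and that the Kummer
  condition `[K(α₀^{1/q}, ϑ₁^{1/q},…,ϑₙ^{1/q}) : K] = q^{n+1}` is satisfied" (render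
  `HOME/lit/renders/Yu2013_p319.png` of the cell abc-stewartyu);
* A. Baker, G. Wüstholz, *Logarithmic Forms and Diophantine Geometry* (2007), §7.2 p. 150.
The passage from the exponent form to the field-degree form `[ℚ(√θ₁,…,√θ_r) : ℚ] = 2^r` is the
tree's `Literature.Barriers.ABC.Multiquadratic.finrank_adjoin_eq_two_pow_of_mul_self_eq_base`
(resp. `Multicubic.finrank_adjoin_eq_three_pow_of_cube_eq` for `q = 3`); it is not repeated here.

PROVED here (no top-level definitions, no named facts): `dvd_of_prod_zpow_eq_pow_of_saturated` (commutative
groups, any `q`), `dvd_of_prod_zpow_eq_pow` (fields, any `q`), `two_dvd_of_prod_zpow_eq_sq` and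
`not_isSquare_prod_of_saturated` (`q = 2`: saturation "up to sign" — the only square roots of `1` in a
field are `±1`), `three_dvd_of_prod_zpow_eq_cube_rat` and `prod_zpow_ne_cube_rat` (`q = 3` over `ℚ`,
where `1` is the only cube root of unity). The proof is the parity argument of
`PadicKummer.not_isSquare_prod_gen_basis`, run for a general saturated system: `∏θ^κ = g^q` and
`ε g = ∏θ^c` give `∏ θ^{κ − q c} = 1`, hence `κ = q c` by independence.

ALSO PROVED (appended): `exists_saturated_basis_rat` — for positive multiplicatively independent
`α₁,…,αₙ ∈ ℚ` a saturated basis `θ₁,…,θₙ` EXISTS (positive, independent, `⟨α⟩ ≤ ⟨θ⟩`, `q`-saturated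
up to sign for all `q ≥ 1`, each `θᵢ` with a non-zero power in `⟨α⟩`; valuation-vector
construction in `ℤ^P` with `Submodule.basisOfPid`, rank `n`), and `exists_kummer_basis_rat` — that
basis satisfies the `2`- and the `3`-Kummer conditions (Nesterenko Cor. 4.5 over `ℚ` in full);
`exists_kummer_basis_rat_of_ne_zero` — the same for non-zero `αⱼ` of any sign (`αⱼ = ±∏θᵢ^{cᵢ}`),
with `p`-adic units going to `p`-adic units (Yu 2013 p. 319's setting over `ℚ`).

WHAT THIS IS NOT: no HEIGHT CONTROL of the `θᵢ` (Nesterenko Prop. 3.7's index bound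
`N ≤ 2n(2e)ⁿ Ω`, Minkowski/Mahler–Weyl small bases) — that geometry-of-numbers layer depends on the
consuming frame (cell abc-stewartyu, HOME/plan-m3/next/AFTER-M3-GENERAL-ALPHA-BRIEF.md §3.2: the
frames may instead run on the exponent lattice with the weights of `α`); nothing analytic is proved
here.

## References

* [Nesterenko2003] Yu. V. Nesterenko, Linear forms in logarithms of rational numbers, in:
  Diophantine Approximation (Cetraro 2000), LNM 1819, Springer 2003 — §4.3, Lemma 4.4, Cor. 4.5.
* [Yu2013] K. Yu, p-adic logarithmic forms and a problem of Erdős, Acta Math. 211 (2013) 315–382 —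
  §1.1, p. 319 (q-saturated lattice; Kummer condition).
* [BakerWustholz2007] A. Baker, G. Wüstholz, Logarithmic Forms and Diophantine Geometry, CUP 2007 —
  §7.2, p. 150.
-/

open Finset

namespace Literature.NumberTheory.DiophantineGeometry.KummerSaturated

/-! ### Commutative groups, any exponent `q` -/

/-- **Kummer's condition for a `q`-saturated independent system (abstract form).** Let `θ₁,…,θ_r`
be multiplicatively independent elements of a commutative group `G` such that the subgroup `⟨θ⟩`
they generate is `q`-saturated up to `q`-th roots of unity: whenever `g^q ∈ ⟨θ⟩` there is `ε` with
`ε^q = 1` and `ε g ∈ ⟨θ⟩`. Then `∏ θᵢ^{κᵢ} = g^q` forces `q ∣ κᵢ` for all `i` (for `q = 2`: no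
product `∏ θᵢ^{κᵢ}` with some `κᵢ` odd is a square). This is the content of Nesterenko's
Corollary 4.5 / Yu's remark that a basis of the `q`-saturated lattice "satisfies the Kummer
condition". [cite: Nesterenko2003, §4.3 Cor. 4.5 (4.48)] [cite: Yu2013, §1.1 p. 319] -/
theorem dvd_of_prod_zpow_eq_pow_of_saturated {G : Type*} [CommGroup G] {r : ℕ} (θ : Fin r → G)
    (q : ℕ) (hind : ∀ μ : Fin r → ℤ, ∏ i, θ i ^ μ i = 1 → μ = 0)
    (hsat : ∀ g : G, g ^ q ∈ Subgroup.closure (Set.range θ) →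
      ∃ ε : G, ε ^ q = 1 ∧ ε * g ∈ Subgroup.closure (Set.range θ))
    {κ : Fin r → ℤ} {g : G} (h : ∏ i, θ i ^ κ i = g ^ q) : ∀ i, (q : ℤ) ∣ κ i := by
  have hmem : g ^ q ∈ Subgroup.closure (Set.range θ) := by
    rw [← h]
    exact Subgroup.prod_mem _ fun i _ =>
      Subgroup.zpow_mem _ (Subgroup.subset_closure (Set.mem_range_self i)) _
  obtain ⟨ε, hε, hεg⟩ := hsat g hmem
  obtain ⟨c, hc⟩ := Subgroup.mem_closure_range_iff_of_fintype.mp hεg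
  have key : ∏ i, θ i ^ (κ i - c i * q) = 1 := by
    have h1 : ∏ i, θ i ^ (κ i - c i * q) = (∏ i, θ i ^ κ i) * ((∏ i, θ i ^ c i) ^ q)⁻¹ := by
      rw [← prod_pow, ← prod_inv_distrib, ← prod_mul_distrib]
      refine prod_congr rfl fun i _ => ?_
      rw [zpow_sub, zpow_mul, zpow_natCast]
    rw [h1, h, ← hc, mul_pow, hε, one_mul, mul_inv_cancel]
  have hzero := hind _ key
  intro i
  have hi := congr_fun hzero i
  simp only [Pi.zero_apply, sub_eq_zero] at hi
  exact ⟨c i, by rw [hi, mul_comm]⟩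

/-! ### Fields, any exponent `q` (non-zero generators) -/

/-- **Kummer's condition for a `q`-saturated independent system of non-zero field elements.**
`θ₁,…,θ_r ∈ K*` multiplicatively independent; saturation hypothesis in product form: every `γ`
with `γ^q = ∏ θᵢ^{cᵢ}` satisfies `ε γ = ∏ θᵢ^{c'ᵢ}` for some `ε` with `ε^q = 1`. Then
`∏ θᵢ^{κᵢ} = γ^q ⇒ q ∣ κᵢ` for all `i`. [cite: Nesterenko2003, §4.3 Cor. 4.5 (4.48)]
[cite: Yu2013, §1.1 p. 319] -/
theorem dvd_of_prod_zpow_eq_pow {K : Type*} [Field K] {r : ℕ} {θ : Fin r → K}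
    (hθ : ∀ i, θ i ≠ 0) (q : ℕ) (hind : ∀ μ : Fin r → ℤ, ∏ i, θ i ^ μ i = 1 → μ = 0)
    (hsat : ∀ γ : K, (∃ c : Fin r → ℤ, γ ^ q = ∏ i, θ i ^ c i) →
      ∃ ε : K, ε ^ q = 1 ∧ ∃ c : Fin r → ℤ, ε * γ = ∏ i, θ i ^ c i)
    {κ : Fin r → ℤ} {γ : K} (h : ∏ i, θ i ^ κ i = γ ^ q) : ∀ i, (q : ℤ) ∣ κ i := by
  obtain ⟨ε, hε, c, hc⟩ := hsat γ ⟨κ, h.symm⟩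
  have hprod_ne : (∏ i, θ i ^ c i) ≠ 0 := prod_ne_zero_iff.mpr fun i _ => zpow_ne_zero _ (hθ i)
  have key : ∏ i, θ i ^ (κ i - c i * q) = 1 := by
    have h1 : ∏ i, θ i ^ (κ i - c i * q) = (∏ i, θ i ^ κ i) * ((∏ i, θ i ^ c i) ^ q)⁻¹ := by
      rw [← prod_pow, ← prod_inv_distrib, ← prod_mul_distrib]
      refine prod_congr rfl fun i _ => ?_
      rw [zpow_sub₀ (hθ i), zpow_mul, zpow_natCast, div_eq_mul_inv]
    rw [h1, h, ← hc, mul_pow, hε, one_mul, mul_inv_cancel₀ (pow_ne_zero _ ?_)]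
    rintro rfl
    simp only [mul_zero] at hc
    exact hprod_ne hc.symm
  have hzero := hind _ key
  intro i
  have hi := congr_fun hzero i
  simp only [Pi.zero_apply, sub_eq_zero] at hi
  exact ⟨c i, by rw [hi, mul_comm]⟩

/-! ### `q = 2`: saturation up to sign; no sub-product is a square -/

/-- **`q = 2`.** If `⟨θ⟩` is `2`-saturated up to sign in a field `K` (every `γ` with
`γ² = ∏ θᵢ^{cᵢ}` has `γ` or `−γ` of the form `∏ θᵢ^{c'ᵢ}`) and the `θᵢ` are multiplicatively
independent, then `∏ θᵢ^{κᵢ} = γ²` forces all `κᵢ` even — the `2`-Kummer condition of the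
Baker–Stark descent for the system `θ` (Nesterenko's Cor. 4.5 for the saturated basis of `𝔑`).
[cite: Nesterenko2003, §4.3 Lemma 4.4, Cor. 4.5] [cite: BakerWustholz2007, §7.2 p. 150] -/
theorem two_dvd_of_prod_zpow_eq_sq {K : Type*} [Field K] {r : ℕ} {θ : Fin r → K}
    (hθ : ∀ i, θ i ≠ 0) (hind : ∀ μ : Fin r → ℤ, ∏ i, θ i ^ μ i = 1 → μ = 0)
    (hsat : ∀ γ : K, (∃ c : Fin r → ℤ, γ ^ 2 = ∏ i, θ i ^ c i) →
      ∃ c : Fin r → ℤ, γ = ∏ i, θ i ^ c i ∨ -γ = ∏ i, θ i ^ c i)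
    {κ : Fin r → ℤ} {γ : K} (h : ∏ i, θ i ^ κ i = γ ^ 2) : ∀ i, (2 : ℤ) ∣ κ i := by
  refine dvd_of_prod_zpow_eq_pow hθ 2 hind (fun γ' hγ' => ?_) h
  obtain ⟨c, hc | hc⟩ := hsat γ' hγ'
  · exact ⟨1, one_pow 2, c, by rw [one_mul]; exact hc⟩
  · exact ⟨-1, by norm_num, c, by rw [neg_one_mul]; exact hc⟩

/-- **`q = 2`, sub-product form** (the hypothesis `hind` of the tree's `2`-descent
`Literature.NumberTheory.Transcendental.CW77.descent_algebra`): under the same hypotheses, for every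
non-empty set `T` of indices `∏_{i ∈ T} θᵢ` is not a square in `K`.
[cite: Nesterenko2003, §4.3 Cor. 4.5 (4.48)] [cite: BakerWustholz2007, §7.2 p. 150] -/
theorem not_isSquare_prod_of_saturated {K : Type*} [Field K] {r : ℕ} {θ : Fin r → K}
    (hθ : ∀ i, θ i ≠ 0) (hind : ∀ μ : Fin r → ℤ, ∏ i, θ i ^ μ i = 1 → μ = 0)
    (hsat : ∀ γ : K, (∃ c : Fin r → ℤ, γ ^ 2 = ∏ i, θ i ^ c i) →
      ∃ c : Fin r → ℤ, γ = ∏ i, θ i ^ c i ∨ -γ = ∏ i, θ i ^ c i)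
    (T : Finset (Fin r)) (hT : T.Nonempty) : ¬ IsSquare (∏ i ∈ T, θ i) := by
  classical
  rintro ⟨γ, hγ⟩
  obtain ⟨i₀, hi₀⟩ := hT
  set κ : Fin r → ℤ := fun i => if i ∈ T then 1 else 0 with hκ
  have hprod : ∏ i, θ i ^ κ i = γ ^ 2 := by
    have : ∏ i, θ i ^ κ i = ∏ i ∈ T, θ i := by
      rw [← prod_filter_mul_prod_filter_not univ (· ∈ T)]
      have hA : ∏ i ∈ univ.filter (· ∈ T), θ i ^ κ i = ∏ i ∈ T, θ i := by
        rw [filter_mem_eq_inter, univ_inter]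
        exact prod_congr rfl fun i hi => by simp [hκ, hi]
      have hB : ∏ i ∈ univ.filter (fun i => ¬ i ∈ T), θ i ^ κ i = 1 :=
        prod_eq_one fun i hi => by
          simp only [mem_filter, mem_univ, true_and] at hi
          simp [hκ, hi]
      rw [hA, hB, mul_one]
    rw [this, hγ, sq]
  have h2 := two_dvd_of_prod_zpow_eq_sq hθ hind hsat hprod i₀
  simp only [hκ, hi₀, if_true] at h2
  omega

/-! ### `q = 3` over `ℚ`: `1` is the only cube root of unity -/

/-- **`q = 3` over `ℚ`.** If `⟨θ⟩ ≤ ℚ*` is `3`-saturated (every `γ ∈ ℚ` with `γ³ = ∏ θᵢ^{cᵢ}` is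
itself of the form `∏ θᵢ^{c'ᵢ}`; no root-of-unity ambiguity since `ε³ = 1 ⇒ ε = 1` in `ℚ`) and the
`θᵢ` are multiplicatively independent, then `∏ θᵢ^{κᵢ} = γ³` forces `3 ∣ κᵢ` for all `i` — the
`3`-Kummer condition used at `p = 2` (Yu's `q = 3`, (1.3)). [cite: Yu2013, §1.1 (1.3) and p. 319]
[cite: Nesterenko2003, §4.3 Cor. 4.5] -/
theorem three_dvd_of_prod_zpow_eq_cube_rat {r : ℕ} {θ : Fin r → ℚ}
    (hθ : ∀ i, θ i ≠ 0) (hind : ∀ μ : Fin r → ℤ, ∏ i, θ i ^ μ i = 1 → μ = 0)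
    (hsat : ∀ γ : ℚ, (∃ c : Fin r → ℤ, γ ^ 3 = ∏ i, θ i ^ c i) →
      ∃ c : Fin r → ℤ, γ = ∏ i, θ i ^ c i)
    {κ : Fin r → ℤ} {γ : ℚ} (h : ∏ i, θ i ^ κ i = γ ^ 3) : ∀ i, (3 : ℤ) ∣ κ i := by
  refine dvd_of_prod_zpow_eq_pow hθ 3 hind (fun γ' hγ' => ?_) h
  obtain ⟨c, hc⟩ := hsat γ' hγ'
  exact ⟨1, one_pow 3, c, by rw [one_mul]; exact hc⟩

/-- **`q = 3` over `ℚ`, contrapositive form** (verbatim the `3`-Kummer hypothesis shape of the cell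
abc-stewartyu's `2`-adic engines: "`(∃ j, ¬ 3 ∣ κ j) → ∀ γ : ℚ, ∏ θⱼ^{κ j} ≠ γ³`").
[cite: Yu2013, §1.1 (1.3) and p. 319] [cite: Nesterenko2003, §4.3 Cor. 4.5] -/
theorem prod_zpow_ne_cube_rat {r : ℕ} {θ : Fin r → ℚ}
    (hθ : ∀ i, θ i ≠ 0) (hind : ∀ μ : Fin r → ℤ, ∏ i, θ i ^ μ i = 1 → μ = 0)
    (hsat : ∀ γ : ℚ, (∃ c : Fin r → ℤ, γ ^ 3 = ∏ i, θ i ^ c i) →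
      ∃ c : Fin r → ℤ, γ = ∏ i, θ i ^ c i)
    (κ : Fin r → ℤ) (hκ : ∃ j, ¬ (3 : ℤ) ∣ κ j) (γ : ℚ) : ∏ i, θ i ^ κ i ≠ γ ^ 3 := by
  intro h
  obtain ⟨j, hj⟩ := hκ
  exact hj (three_dvd_of_prod_zpow_eq_cube_rat hθ hind hsat h j)


/-! ### Existence of a saturated (hence Kummer) basis over `ℚ_{>0}`

The Loher–Masser / Nesterenko saturation step: the subgroup of `ℚ_{>0}` generated by
multiplicatively independent `α₁,…,αₙ` sits with finite index in its SATURATION (all positive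
rationals having a power in it), which is free of the same rank `n`; a basis `θ` of the saturation
is saturated in the sense of the theorems above, hence satisfies every `q`-Kummer condition. The
construction runs in the lattice `ℤ^P` of valuation vectors (`P` = the primes of the `αⱼ`): a
positive rational is determined by its valuations (`eq_of_padicValRat_eq`), the saturation of the
span of the valuation vectors is a free `ℤ`-module (`Submodule.basisOfPid`), and its rank is `n`
(the `αⱼ`'s vectors are independent inside it; non-zero multiples of its basis lie in their span).
-/

open Submodule


/-! ### Positive rationals are determined by their valuations -/

/-- A positive rational all of whose `p`-adic valuations vanish is `1`. [folklore] -/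
private theorem eq_one_of_padicValRat_eq_zero {x : ℚ} (hx : 0 < x)
    (h : ∀ p : ℕ, p.Prime → padicValRat p x = 0) : x = 1 := by
  have hnum : 0 < x.num := Rat.num_pos.mpr hx
  have hcop : Nat.Coprime x.num.natAbs x.den := x.reduced
  have hnumabs : x.num.natAbs ≠ 0 := Int.natAbs_ne_zero.mpr hnum.ne'
  have key : ∀ p : ℕ, p.Prime → ¬ p ∣ x.num.natAbs ∧ ¬ p ∣ x.den := by
    intro p hp
    haveI := Fact.mk hp
    have h0 : (padicValNat p x.num.natAbs : ℤ) - (padicValNat p x.den : ℤ) = 0 := by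
      have := h p hp
      rwa [padicValRat_def, padicValInt] at this
    have hnot : ¬ (p ∣ x.num.natAbs ∧ p ∣ x.den) := fun ⟨hn, hd⟩ =>
      hp.one_lt.ne' (Nat.eq_one_of_dvd_one (hcop ▸ Nat.dvd_gcd hn hd))
    by_cases hn : p ∣ x.num.natAbs
    · have hd : ¬ p ∣ x.den := fun hd => hnot ⟨hn, hd⟩
      have h1 : padicValNat p x.den = 0 := padicValNat.eq_zero_of_not_dvd hd
      have h2 : 1 ≤ padicValNat p x.num.natAbs := one_le_padicValNat_of_dvd hnumabs hn
      omega
    · by_cases hd : p ∣ x.den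
      · have h1 : padicValNat p x.num.natAbs = 0 := padicValNat.eq_zero_of_not_dvd hn
        have h2 : 1 ≤ padicValNat p x.den := one_le_padicValNat_of_dvd x.den_nz hd
        omega
      · exact ⟨hn, hd⟩
  have hn1 : x.num.natAbs = 1 := Nat.eq_one_iff_not_exists_prime_dvd.mpr fun p hp => (key p hp).1
  have hd1 : x.den = 1 := Nat.eq_one_iff_not_exists_prime_dvd.mpr fun p hp => (key p hp).2
  have hnum1 : x.num = 1 := by
    have := Int.natAbs_eq x.num
    rw [hn1] at this
    rcases this with h1 | h1
    · exact_mod_cast h1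
    · exfalso; rw [h1] at hnum; norm_num at hnum
  exact Rat.ext hnum1 hd1

/-- Two positive rationals with the same valuation at every prime are equal. [folklore] -/
private theorem eq_of_padicValRat_eq {x y : ℚ} (hx : 0 < x) (hy : 0 < y)
    (h : ∀ p : ℕ, p.Prime → padicValRat p x = padicValRat p y) : x = y := by
  have hxy : x / y = 1 := by
    refine eq_one_of_padicValRat_eq_zero (div_pos hx hy) fun p hp => ?_
    haveI := Fact.mk hp
    rw [padicValRat.div hx.ne' hy.ne', h p hp, sub_self]
  rwa [div_eq_one_iff_eq hy.ne'] at hxy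

/-- Valuation of a product of integer powers of non-zero rationals. [folklore] -/
private theorem padicValRat_prod_zpow {p : ℕ} [Fact p.Prime] {m : ℕ} (θ : Fin m → ℚ)
    (hθ : ∀ i, θ i ≠ 0) (c : Fin m → ℤ) :
    padicValRat p (∏ i, θ i ^ c i) = ∑ i, c i * padicValRat p (θ i) := by
  classical
  have key : ∀ s : Finset (Fin m),
      padicValRat p (∏ i ∈ s, θ i ^ c i) = ∑ i ∈ s, c i * padicValRat p (θ i) := by
    intro s
    induction s using Finset.induction_on with
    | empty => simp
    | insert a s ha ih =>
      rw [prod_insert ha, sum_insert ha, padicValRat.mul (zpow_ne_zero _ (hθ a))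
        (prod_ne_zero_iff.mpr fun i _ => zpow_ne_zero _ (hθ i)), ih, padicValRat.zpow]
  exact key univ




/-- Valuation of a product of integer powers of non-zero rationals, arbitrary finite index type.
[folklore] -/
private theorem padicValRat_prod_zpow' {p : ℕ} [Fact p.Prime] {ι : Type*} [Fintype ι]
    [DecidableEq ι] (θ : ι → ℚ) (hθ : ∀ i, θ i ≠ 0) (c : ι → ℤ) :
    padicValRat p (∏ i, θ i ^ c i) = ∑ i, c i * padicValRat p (θ i) := by
  have key : ∀ s : Finset ι,
      padicValRat p (∏ i ∈ s, θ i ^ c i) = ∑ i ∈ s, c i * padicValRat p (θ i) := by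
    intro s
    induction s using Finset.induction_on with
    | empty => simp
    | insert a s ha ih =>
      rw [prod_insert ha, sum_insert ha, padicValRat.mul (zpow_ne_zero _ (hθ a))
        (prod_ne_zero_iff.mpr fun i _ => zpow_ne_zero _ (hθ i)), ih, padicValRat.zpow]
  exact key univ

/-- The valuation at a prime `ℓ` of a prime `p` (as a rational): `1` if `ℓ = p`, else `0`.
[folklore] -/
private theorem padicValRat_prime (ℓ p : ℕ) (hℓ : ℓ.Prime) (hp : p.Prime) :
    padicValRat ℓ (p : ℚ) = if ℓ = p then 1 else 0 := by
  haveI := Fact.mk hℓ; haveI := Fact.mk hp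
  rw [← padicValRat_of_nat]
  split_ifs with h
  · subst h; simp [padicValNat_self]
  · simp [padicValNat_primes h]

/-- Test: the product `∏_{p ∈ P} p^{b p}` has valuation `b p` at `p ∈ P` and `0` at primes outside
`P`. [folklore] -/
private theorem padicValRat_prod_prime_zpow (P : Finset ℕ) (hP : ∀ p ∈ P, p.Prime)
    (b : {p // p ∈ P} → ℤ) (ℓ : ℕ) (hℓ : ℓ.Prime) :
    padicValRat ℓ (∏ p : {p // p ∈ P}, ((p.1 : ℕ) : ℚ) ^ b p) =
      if h : ℓ ∈ P then b ⟨ℓ, h⟩ else 0 := by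
  classical
  haveI := Fact.mk hℓ
  rw [padicValRat_prod_zpow' _ (fun p => by exact_mod_cast (hP p.1 p.2).ne_zero)]
  simp_rw [padicValRat_prime ℓ _ hℓ (hP _ (Subtype.prop _))]
  split_ifs with h
  · rw [Finset.sum_eq_single ⟨ℓ, h⟩]
    · simp
    · intro p _ hp
      have : ℓ ≠ p.1 := fun e => hp (Subtype.ext e.symm)
      simp [this]
    · simp
  · refine Finset.sum_eq_zero fun p _ => ?_
    have : ℓ ≠ p.1 := fun e => h (e ▸ p.2)
    simp [this]




/-- A prime outside the prime support of numerator and denominator has valuation `0`. [folklore] -/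
private theorem padicValRat_eq_zero_of_not_mem {x : ℚ} (hx : x ≠ 0) {ℓ : ℕ} (hℓ : ℓ.Prime)
    (h : ℓ ∉ x.num.natAbs.primeFactors ∪ x.den.primeFactors) : padicValRat ℓ x = 0 := by
  haveI := Fact.mk hℓ
  rw [Finset.mem_union, not_or, Nat.mem_primeFactors_of_ne_zero (Int.natAbs_ne_zero.mpr
    (Rat.num_ne_zero.mpr hx)), Nat.mem_primeFactors_of_ne_zero x.den_nz] at h
  have hn : ¬ ℓ ∣ x.num.natAbs := fun hd => h.1 ⟨hℓ, hd⟩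
  have hd : ¬ ℓ ∣ x.den := fun hd => h.2 ⟨hℓ, hd⟩
  rw [padicValRat_def, padicValInt, padicValNat.eq_zero_of_not_dvd hn,
    padicValNat.eq_zero_of_not_dvd hd]
  simp

/-- **Existence of a saturated basis (Loher–Masser / Nesterenko Cor. 4.5 construction) — core.**
For positive rationals `α₁,…,αₙ`, multiplicatively independent, there are an `m`, positive
rationals `θ₁,…,θ_m`, multiplicatively independent, generating a subgroup of `ℚ_{>0}` that
contains every `αⱼ`, is `q`-saturated up to sign for every `q ≥ 1`, each `θᵢ` having a non-zero
power in `⟨α⟩`; and `m = n`. [cite: Nesterenko2003, §4.3 Cor. 4.5] [cite: Yu2013, §1.1 p. 319] -/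
private theorem exists_saturated_basis_aux {n : ℕ} (α : Fin n → ℚ) (hα : ∀ j, 0 < α j)
    (hind : ∀ μ : Fin n → ℤ, ∏ j, α j ^ μ j = 1 → μ = 0) :
    ∃ (m : ℕ) (θ : Fin m → ℚ), m = n ∧ (∀ i, 0 < θ i) ∧
      (∀ μ : Fin m → ℤ, ∏ i, θ i ^ μ i = 1 → μ = 0) ∧
      (∀ j, ∃ c : Fin m → ℤ, α j = ∏ i, θ i ^ c i) ∧
      (∀ q : ℕ, 0 < q → ∀ γ : ℚ, (∃ c : Fin m → ℤ, γ ^ q = ∏ i, θ i ^ c i) →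
        ∃ c : Fin m → ℤ, γ = ∏ i, θ i ^ c i ∨ -γ = ∏ i, θ i ^ c i) ∧
      (∀ i, ∃ k : ℤ, k ≠ 0 ∧ ∃ c : Fin n → ℤ, θ i ^ k = ∏ j, α j ^ c j) := by
  classical
  -- the prime support and the valuation vectors
  set P : Finset ℕ := univ.biUnion fun j => (α j).num.natAbs.primeFactors ∪ (α j).den.primeFactors
    with hP
  have hPprime : ∀ p ∈ P, p.Prime := by
    intro p hp
    simp only [hP, mem_biUnion, mem_univ, true_and, mem_union] at hp
    obtain ⟨j, hj | hj⟩ := hp <;> exact Nat.prime_of_mem_primeFactors hj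
  have hα0 : ∀ j, α j ≠ 0 := fun j => (hα j).ne'
  have hαsupp : ∀ j (ℓ : ℕ), ℓ.Prime → ℓ ∉ P → padicValRat ℓ (α j) = 0 := by
    intro j ℓ hℓ hℓP
    refine padicValRat_eq_zero_of_not_mem (hα0 j) hℓ fun hmem => hℓP ?_
    simp only [hP, mem_biUnion, mem_univ, true_and]
    exact ⟨j, hmem⟩
  -- index type and ambient lattice
  set ι := {p : ℕ // p ∈ P} with hι
  let v : ℚ → (ι → ℤ) := fun x p => padicValRat p.1 x
  have hv_prod : ∀ {κ : Type} [Fintype κ] (θ : κ → ℚ) (hθ : ∀ i, θ i ≠ 0) (c : κ → ℤ),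
      v (∏ i, θ i ^ c i) = ∑ i, c i • v (θ i) := by
    intro κ _ θ hθ c
    classical
    funext p
    haveI := Fact.mk (hPprime p.1 p.2)
    simp only [v, Finset.sum_apply, Pi.smul_apply, smul_eq_mul]
    exact padicValRat_prod_zpow' θ hθ c
  let L : Submodule ℤ (ι → ℤ) := span ℤ (Set.range fun j => v (α j))
  let Lsat : Submodule ℤ (ι → ℤ) :=
    { carrier := {w | ∃ k : ℤ, k ≠ 0 ∧ k • w ∈ L}
      add_mem' := by
        rintro w₁ w₂ ⟨k₁, hk₁, h₁⟩ ⟨k₂, hk₂, h₂⟩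
        refine ⟨k₁ * k₂, mul_ne_zero hk₁ hk₂, ?_⟩
        have e : (k₁ * k₂) • (w₁ + w₂) = k₂ • (k₁ • w₁) + k₁ • (k₂ • w₂) := by
          funext p; simp only [Pi.smul_apply, Pi.add_apply, smul_eq_mul]; ring
        rw [e]
        exact L.add_mem (L.smul_mem _ h₁) (L.smul_mem _ h₂)
      zero_mem' := ⟨1, one_ne_zero, by rw [smul_zero]; exact L.zero_mem⟩
      smul_mem' := by
        rintro c w ⟨k, hk, h⟩
        exact ⟨k, hk, by rw [smul_comm]; exact L.smul_mem c h⟩ }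
  have mem_Lsat : ∀ w, w ∈ Lsat ↔ ∃ k : ℤ, k ≠ 0 ∧ k • w ∈ L := fun w => Iff.rfl
  have hL_le : L ≤ Lsat := fun w hw => (mem_Lsat w).mpr ⟨1, one_ne_zero, by simpa using hw⟩
  have hLsat_sat : ∀ (k : ℤ), k ≠ 0 → ∀ w, k • w ∈ Lsat → w ∈ Lsat := by
    intro k hk w hw
    obtain ⟨l, hl, hlw⟩ := (mem_Lsat _).mp hw
    exact (mem_Lsat w).mpr ⟨l * k, mul_ne_zero hl hk, by rw [mul_smul]; exact hlw⟩
  -- a basis of the saturation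
  obtain ⟨m, bS⟩ := Submodule.basisOfPid (Pi.basisFun ℤ ι) Lsat
  let b : Fin m → (ι → ℤ) := fun i => (bS i : ι → ℤ)
  have hbLI : LinearIndependent ℤ b :=
    bS.linearIndependent.map' Lsat.subtype (Submodule.ker_subtype Lsat)
  have hb_mem : ∀ i, b i ∈ Lsat := fun i => (bS i).2
  -- the new generators
  let θ : Fin m → ℚ := fun i => ∏ p : ι, ((p.1 : ℕ) : ℚ) ^ b i p
  have hθpos : ∀ i, 0 < θ i := fun i =>
    prod_pos fun p _ => zpow_pos (by exact_mod_cast (hPprime p.1 p.2).pos) _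
  have hθ0 : ∀ i, θ i ≠ 0 := fun i => (hθpos i).ne'
  have hθval : ∀ i (ℓ : ℕ), ℓ.Prime →
      padicValRat ℓ (θ i) = if h : ℓ ∈ P then b i ⟨ℓ, h⟩ else 0 := fun i ℓ hℓ =>
    padicValRat_prod_prime_zpow P hPprime (b i) ℓ hℓ
  have hvθ : ∀ i, v (θ i) = b i := by
    intro i; funext p
    show padicValRat p.1 (θ i) = b i p
    rw [hθval i p.1 (hPprime p.1 p.2), dif_pos p.2]
  have hθsupp : ∀ i (ℓ : ℕ), ℓ.Prime → ℓ ∉ P → padicValRat ℓ (θ i) = 0 := by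
    intro i ℓ hℓ hℓP; rw [hθval i ℓ hℓ, dif_neg hℓP]
  -- products of powers of θ: valuations
  have hθprod_supp : ∀ (c : Fin m → ℤ) (ℓ : ℕ), ℓ.Prime → ℓ ∉ P →
      padicValRat ℓ (∏ i, θ i ^ c i) = 0 := by
    intro c ℓ hℓ hℓP
    haveI := Fact.mk hℓ
    rw [padicValRat_prod_zpow' θ hθ0 c]
    exact Finset.sum_eq_zero fun i _ => by rw [hθsupp i ℓ hℓ hℓP, mul_zero]
  have hθprod_v : ∀ c : Fin m → ℤ, v (∏ i, θ i ^ c i) = ∑ i, c i • b i := by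
    intro c; rw [hv_prod θ hθ0 c]; simp only [hvθ]
  -- KEY: a positive rational whose valuation vector is `∑ cᵢ bᵢ` and which vanishes off `P` is `∏ θᵢ^{cᵢ}`
  have recon : ∀ (x : ℚ), 0 < x → (∀ ℓ : ℕ, ℓ.Prime → ℓ ∉ P → padicValRat ℓ x = 0) →
      ∀ c : Fin m → ℤ, v x = ∑ i, c i • b i → x = ∏ i, θ i ^ c i := by
    intro x hx hxsupp c hvx
    refine eq_of_padicValRat_eq hx (prod_pos fun i _ => zpow_pos (hθpos i) _) fun ℓ hℓ => ?_
    by_cases hℓP : ℓ ∈ P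
    · have h1 := congr_fun hvx ⟨ℓ, hℓP⟩
      have h2 := congr_fun (hθprod_v c) ⟨ℓ, hℓP⟩
      simp only [v] at h1 h2
      rw [h1, h2]
    · rw [hxsupp ℓ hℓ hℓP, hθprod_supp c ℓ hℓ hℓP]
  -- (1) independence of θ
  have hθind : ∀ μ : Fin m → ℤ, ∏ i, θ i ^ μ i = 1 → μ = 0 := by
    intro μ hμ
    have h0 : ∑ i, μ i • b i = 0 := by
      rw [← hθprod_v μ, hμ]; funext p; simp [v]
    funext i
    exact Fintype.linearIndependent_iff.mp hbLI μ h0 i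
  -- (2) each α j is a product of powers of θ
  have hαgen : ∀ j, ∃ c : Fin m → ℤ, α j = ∏ i, θ i ^ c i := by
    intro j
    have hw : v (α j) ∈ Lsat := hL_le (subset_span ⟨j, rfl⟩)
    refine ⟨fun i => bS.repr ⟨v (α j), hw⟩ i, recon (α j) (hα j) (hαsupp j) _ ?_⟩
    have := congr_arg Lsat.subtype (bS.sum_repr ⟨v (α j), hw⟩)
    simp only [map_sum, map_zsmul, Submodule.subtype_apply] at this
    exact this.symm
  -- (3) saturation up to sign
  have hsat : ∀ q : ℕ, 0 < q → ∀ γ : ℚ, (∃ c : Fin m → ℤ, γ ^ q = ∏ i, θ i ^ c i) →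
      ∃ c : Fin m → ℤ, γ = ∏ i, θ i ^ c i ∨ -γ = ∏ i, θ i ^ c i := by
    intro q hq γ ⟨c, hc⟩
    have hγ0 : γ ≠ 0 := by
      rintro rfl
      rw [zero_pow hq.ne'] at hc
      exact (prod_ne_zero_iff.mpr fun i _ => zpow_ne_zero _ (hθ0 i)) hc.symm
    set g : ℚ := |γ| with hg
    have hgpos : 0 < g := abs_pos.mpr hγ0
    have hvg : ∀ ℓ : ℕ, padicValRat ℓ g = padicValRat ℓ γ := by
      intro ℓ; rcases abs_choice γ with h | h <;> rw [hg, h]; rw [padicValRat.neg]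
    have hgsupp : ∀ ℓ : ℕ, ℓ.Prime → ℓ ∉ P → padicValRat ℓ g = 0 := by
      intro ℓ hℓ hℓP
      haveI := Fact.mk hℓ
      have h1 : padicValRat ℓ (γ ^ q) = 0 := by rw [hc]; exact hθprod_supp c ℓ hℓ hℓP
      rw [← zpow_natCast, padicValRat.zpow] at h1
      rw [hvg]
      rcases mul_eq_zero.mp h1 with h | h
      · exact absurd (by exact_mod_cast h) hq.ne'
      · exact h
    have hqv : (q : ℤ) • v g ∈ Lsat := by
      have : (q : ℤ) • v g = ∑ i, c i • b i := by
        rw [← hθprod_v c, ← hc]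
        funext p
        haveI := Fact.mk (hPprime p.1 p.2)
        simp only [v, Pi.smul_apply, smul_eq_mul, ← zpow_natCast, padicValRat.zpow, hvg]
      rw [this]
      exact Submodule.sum_mem _ fun i _ => Submodule.smul_mem _ _ (hb_mem i)
    have hvg_mem : v g ∈ Lsat := hLsat_sat q (by exact_mod_cast hq.ne') _ hqv
    refine ⟨fun i => bS.repr ⟨v g, hvg_mem⟩ i, ?_⟩
    have hrepr : v g = ∑ i, (bS.repr ⟨v g, hvg_mem⟩ i) • b i := by
      have := congr_arg Lsat.subtype (bS.sum_repr ⟨v g, hvg_mem⟩)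
      simp only [map_sum, map_zsmul, Submodule.subtype_apply] at this
      exact this.symm
    have hgeq := recon g hgpos hgsupp _ hrepr
    rcases abs_choice γ with h | h
    · left; rw [← h]; exact hgeq
    · right; rw [← h]; exact hgeq
  -- (4) a non-zero power of each θ i lies in ⟨α⟩
  have hθpow : ∀ i, ∃ k : ℤ, k ≠ 0 ∧ ∃ c : Fin n → ℤ, θ i ^ k = ∏ j, α j ^ c j := by
    intro i
    obtain ⟨k, hk, hkb⟩ := (mem_Lsat _).mp (hb_mem i)
    obtain ⟨c, hc⟩ := (Submodule.mem_span_range_iff_exists_fun ℤ).mp hkb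
    refine ⟨k, hk, c, ?_⟩
    refine eq_of_padicValRat_eq (zpow_pos (hθpos i) _) (prod_pos fun j _ => zpow_pos (hα j) _)
      fun ℓ hℓ => ?_
    haveI := Fact.mk hℓ
    by_cases hℓP : ℓ ∈ P
    · have h1 := congr_fun hc ⟨ℓ, hℓP⟩
      simp only [Finset.sum_apply, Pi.smul_apply, smul_eq_mul] at h1
      rw [padicValRat.zpow, padicValRat_prod_zpow' α hα0 c, hθval i ℓ hℓ, dif_pos hℓP, ← h1]
    · rw [padicValRat.zpow, hθsupp i ℓ hℓ hℓP, mul_zero, padicValRat_prod_zpow' α hα0 c]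
      exact (Finset.sum_eq_zero fun j _ => by rw [hαsupp j ℓ hℓ hℓP, mul_zero]).symm
  -- (5) the rank: m = n
  have hαLI : LinearIndependent ℤ (fun j => v (α j)) := by
    refine Fintype.linearIndependent_iff.mpr fun μ hμ => ?_
    suffices hμ0 : μ = 0 from fun i => congr_fun hμ0 i
    apply hind μ
    refine eq_one_of_padicValRat_eq_zero (prod_pos fun j _ => zpow_pos (hα j) _) fun ℓ hℓ => ?_
    haveI := Fact.mk hℓ
    by_cases hℓP : ℓ ∈ P
    · have h1 := congr_fun hμ ⟨ℓ, hℓP⟩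
      simp only [Finset.sum_apply, Pi.smul_apply, smul_eq_mul, Pi.zero_apply] at h1
      rw [padicValRat_prod_zpow' α hα0 μ]; exact h1
    · rw [padicValRat_prod_zpow' α hα0 μ]
      exact Finset.sum_eq_zero fun j _ => by rw [hαsupp j ℓ hℓ hℓP, mul_zero]
  haveI : Module.Finite ℤ Lsat := Module.Finite.of_basis bS
  have hfin : Module.finrank ℤ Lsat = m := by
    rw [Module.finrank_eq_card_basis bS, Fintype.card_fin]
  have hnm : n ≤ m := by
    let f : Fin n → Lsat := fun j => ⟨v (α j), hL_le (subset_span ⟨j, rfl⟩)⟩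
    have hf : LinearIndependent ℤ f := LinearIndependent.of_comp Lsat.subtype hαLI
    have := hf.fintype_card_le_finrank
    rwa [Fintype.card_fin, hfin] at this
  have hmn : m ≤ n := by
    choose k hk hkL using fun i => (mem_Lsat _).mp (hb_mem i)
    let g : Fin m → L := fun i => ⟨k i • b i, hkL i⟩
    have hgM : LinearIndependent ℤ (fun i => k i • b i) := by
      refine Fintype.linearIndependent_iff.mpr fun ν hν => ?_
      have h0 : ∑ i, (ν i * k i) • b i = 0 := by
        simpa only [mul_smul] using hν
      have := Fintype.linearIndependent_iff.mp hbLI _ h0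
      intro i
      have hi := this i
      simp only [mul_eq_zero] at hi
      exact hi.resolve_right (hk i)
    have hg : LinearIndependent ℤ g := LinearIndependent.of_comp L.subtype hgM
    have h1 := hg.fintype_card_le_finrank
    rw [Fintype.card_fin] at h1
    have h2 : Module.finrank ℤ L ≤ n := by
      have := finrank_range_le_card (R := ℤ) (fun j => v (α j))
      simpa [Set.finrank] using this
    exact h1.trans h2
  exact ⟨m, θ, le_antisymm hmn hnm, hθpos, hθind, hαgen, hsat, hθpow⟩


/-- **Existence of a saturated basis over `ℚ_{>0}` (the Loher–Masser / Nesterenko "lattice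
saturation" step of Kummer removal).** Let `α₁,…,αₙ` be positive rationals, multiplicatively
independent. Then there are positive rationals `θ₁,…,θₙ` (same number), multiplicatively independent,
such that (i) every `αⱼ` is a product `∏ θᵢ^{cᵢ}` with integer exponents (`⟨α⟩ ≤ ⟨θ⟩`); (ii) `⟨θ⟩` is
`q`-SATURATED up to sign for every `q ≥ 1`: `γ^q = ∏ θᵢ^{cᵢ}` with `γ ∈ ℚ` forces `±γ = ∏ θᵢ^{c'ᵢ}`;
(iii) each `θᵢ` has a non-zero power in `⟨α⟩` (`θᵢ^k = ∏ αⱼ^{cⱼ}`, `k ≠ 0` — Yu's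
"`ϑᵢ^{[M:ℤⁿ]} ∈ ⟨α₀,…,αₙ⟩`"). Construction: `θᵢ = ∏_p p^{b_{i,p}}` for a `ℤ`-basis `(bᵢ)` of the
saturation, inside `ℤ^P` (`P` = primes of the `αⱼ`), of the lattice spanned by the valuation
vectors `(ord_p αⱼ)_p` — Nesterenko's `θᵢ` with `log θᵢ = Σⱼ u_{ij} log αⱼ` for a basis `ūᵢ` of
`𝔑 = {λ ∈ ℚⁿ : α^λ ∈ ℚ}`, resp. Yu's basis of the saturated Loher–Masser lattice. With
`two_dvd_of_prod_zpow_eq_sq` / `three_dvd_of_prod_zpow_eq_cube_rat` this gives the Kummer condition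
for `θ` (`exists_kummer_basis_rat`). [cite: Nesterenko2003, §4.3 Cor. 4.5 (4.48)]
[cite: Yu2013, §1.1 p. 319] -/
theorem exists_saturated_basis_rat {n : ℕ} (α : Fin n → ℚ) (hα : ∀ j, 0 < α j)
    (hind : ∀ μ : Fin n → ℤ, ∏ j, α j ^ μ j = 1 → μ = 0) :
    ∃ θ : Fin n → ℚ, (∀ i, 0 < θ i) ∧
      (∀ μ : Fin n → ℤ, ∏ i, θ i ^ μ i = 1 → μ = 0) ∧
      (∀ j, ∃ c : Fin n → ℤ, α j = ∏ i, θ i ^ c i) ∧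
      (∀ q : ℕ, 0 < q → ∀ γ : ℚ, (∃ c : Fin n → ℤ, γ ^ q = ∏ i, θ i ^ c i) →
        ∃ c : Fin n → ℤ, γ = ∏ i, θ i ^ c i ∨ -γ = ∏ i, θ i ^ c i) ∧
      (∀ i, ∃ k : ℤ, k ≠ 0 ∧ ∃ c : Fin n → ℤ, θ i ^ k = ∏ j, α j ^ c j) := by
  obtain ⟨m, θ, hmn, h1, h2, h3, h4, h5⟩ := exists_saturated_basis_aux α hα hind
  subst hmn
  exact ⟨θ, h1, h2, h3, h4, h5⟩

/-- **Kummer's condition for free over `ℚ` (both parities).** For positive, multiplicatively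
independent rationals `α₁,…,αₙ` there are positive, multiplicatively independent `θ₁,…,θₙ` with
`⟨α⟩ ≤ ⟨θ⟩`, each `θᵢ` having a non-zero power in `⟨α⟩`, which satisfy the `2`-Kummer condition
(no non-empty sub-product is a square; `∏ θᵢ^{κᵢ} = γ² ⇒ 2 ∣ κᵢ`) AND the `3`-Kummer condition
(`(∃ j, ¬ 3 ∣ κⱼ) ⇒ ∏ θᵢ^{κᵢ} ≠ γ³`) — the hypotheses of the Baker–Stark descents at odd `p`
(`q = 2`) and at `p = 2` (`q = 3`, Yu's (1.3)), obtained at no cost from saturation (Nesterenko's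
Cor. 4.5: `deg ℚ(√θ₁,…,√θₙ) = 2ⁿ`). [cite: Nesterenko2003, §4.3 Lemma 4.4, Cor. 4.5 (4.48)]
[cite: Yu2013, §1.1 (1.3) and p. 319] [cite: BakerWustholz2007, §7.2 p. 150] -/
theorem exists_kummer_basis_rat {n : ℕ} (α : Fin n → ℚ) (hα : ∀ j, 0 < α j)
    (hind : ∀ μ : Fin n → ℤ, ∏ j, α j ^ μ j = 1 → μ = 0) :
    ∃ θ : Fin n → ℚ, (∀ i, 0 < θ i) ∧
      (∀ μ : Fin n → ℤ, ∏ i, θ i ^ μ i = 1 → μ = 0) ∧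
      (∀ j, ∃ c : Fin n → ℤ, α j = ∏ i, θ i ^ c i) ∧
      (∀ i, ∃ k : ℤ, k ≠ 0 ∧ ∃ c : Fin n → ℤ, θ i ^ k = ∏ j, α j ^ c j) ∧
      (∀ T : Finset (Fin n), T.Nonempty → ¬ IsSquare (∏ i ∈ T, θ i)) ∧
      (∀ (κ : Fin n → ℤ) (γ : ℚ), ∏ i, θ i ^ κ i = γ ^ 2 → ∀ i, (2 : ℤ) ∣ κ i) ∧
      (∀ κ : Fin n → ℤ, (∃ j, ¬ (3 : ℤ) ∣ κ j) → ∀ γ : ℚ, ∏ i, θ i ^ κ i ≠ γ ^ 3) := by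
  obtain ⟨θ, hpos, hθind, hgen, hsat, hpow⟩ := exists_saturated_basis_rat α hα hind
  have hθ0 : ∀ i, θ i ≠ 0 := fun i => (hpos i).ne'
  have hsat2 : ∀ γ : ℚ, (∃ c : Fin n → ℤ, γ ^ 2 = ∏ i, θ i ^ c i) →
      ∃ c : Fin n → ℤ, γ = ∏ i, θ i ^ c i ∨ -γ = ∏ i, θ i ^ c i := hsat 2 (by norm_num)
  have hsat3 : ∀ γ : ℚ, (∃ c : Fin n → ℤ, γ ^ 3 = ∏ i, θ i ^ c i) →
      ∃ c : Fin n → ℤ, γ = ∏ i, θ i ^ c i := by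
    rintro γ ⟨c, hc⟩
    obtain ⟨c', hc' | hc'⟩ := hsat 3 (by norm_num) γ ⟨c, hc⟩
    · exact ⟨c', hc'⟩
    · exfalso
      have hγpos : 0 < γ := by
        have h3 : 0 < γ ^ 3 := by rw [hc]; exact prod_pos fun i _ => zpow_pos (hpos i) _
        exact (Odd.pow_pos_iff (by decide : Odd 3)).mp h3
      have : 0 < -γ := by rw [hc']; exact prod_pos fun i _ => zpow_pos (hpos i) _
      linarith
  exact ⟨θ, hpos, hθind, hgen, hpow,
    fun T hT => not_isSquare_prod_of_saturated hθ0 hθind hsat2 T hT,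
    fun κ γ h => two_dvd_of_prod_zpow_eq_sq hθ0 hθind hsat2 h,
    fun κ hκ γ => prod_zpow_ne_cube_rat hθ0 hθind hsat3 κ hκ γ⟩


/-! ### Signed generators and `p`-adic units -/


/-- `(|a|^m)² = (a^m)²`. [folklore] -/
private theorem sq_zpow_abs (a : ℚ) (m : ℤ) : (|a| ^ m) ^ 2 = (a ^ m) ^ 2 := by
  rw [← abs_zpow, sq_abs]

/-- `a^{2m} = (a^m)²`. [folklore] -/
private theorem zpow_two_mul_eq (a : ℚ) (m : ℤ) : a ^ (2 * m) = (a ^ m) ^ 2 := by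
  rw [mul_comm, zpow_mul, zpow_ofNat]

/-- `ord_p |x| = ord_p x`. [folklore] -/
private theorem padicValRat_abs (p : ℕ) (x : ℚ) : padicValRat p |x| = padicValRat p x := by
  rcases abs_choice x with h | h <;> rw [h]; rw [padicValRat.neg]

/-- **Kummer's condition for free over `ℚ*` — signed generators and `p`-adic units** (the form the
`p`-adic engines consume: Yu 2013 p. 319 starts from "a multiplicatively independent set
`𝔞 = {α₁,…,αₙ}` of `𝔭`-adic units" and produces `𝔭`-adic units `ϑ₁,…,ϑₙ` satisfying the Kummer
condition). For non-zero multiplicatively independent rationals `α₁,…,αₙ` (any signs) there are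
POSITIVE, multiplicatively independent `θ₁,…,θₙ` with `αⱼ = ±∏ θᵢ^{cᵢ}`, a non-zero power of each
`θᵢ` in `⟨α⟩`, BOTH Kummer conditions (`q = 2`: no non-empty sub-product a square /
`∏θ^κ = γ² ⇒ 2 ∣ κ`; `q = 3`: `(∃ j, ¬3 ∣ κⱼ) ⇒ ∏θ^κ ≠ γ³`), and: if all `αⱼ` are `p`-adic units
then so are all `θᵢ` (`ord_p θᵢ = 0`, from `θᵢ^k ∈ ⟨α⟩`, `k ≠ 0`). Reduction to
`exists_kummer_basis_rat` for `|α₁|,…,|αₙ|` (independent because `∏|αⱼ|^{μⱼ} = 1` gives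
`∏ αⱼ^{2μⱼ} = 1`). [cite: Yu2013, §1.1 p. 319] [cite: Nesterenko2003, §4.3 Cor. 4.5 (4.48)] -/
theorem exists_kummer_basis_rat_of_ne_zero {n : ℕ} (α : Fin n → ℚ) (hα : ∀ j, α j ≠ 0)
    (hind : ∀ μ : Fin n → ℤ, ∏ j, α j ^ μ j = 1 → μ = 0) :
    ∃ θ : Fin n → ℚ, (∀ i, 0 < θ i) ∧
      (∀ μ : Fin n → ℤ, ∏ i, θ i ^ μ i = 1 → μ = 0) ∧
      (∀ j, ∃ c : Fin n → ℤ, α j = ∏ i, θ i ^ c i ∨ -α j = ∏ i, θ i ^ c i) ∧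
      (∀ i, ∃ k : ℤ, k ≠ 0 ∧ ∃ c : Fin n → ℤ, θ i ^ k = ∏ j, α j ^ c j) ∧
      (∀ T : Finset (Fin n), T.Nonempty → ¬ IsSquare (∏ i ∈ T, θ i)) ∧
      (∀ (κ : Fin n → ℤ) (γ : ℚ), ∏ i, θ i ^ κ i = γ ^ 2 → ∀ i, (2 : ℤ) ∣ κ i) ∧
      (∀ κ : Fin n → ℤ, (∃ j, ¬ (3 : ℤ) ∣ κ j) → ∀ γ : ℚ, ∏ i, θ i ^ κ i ≠ γ ^ 3) ∧
      (∀ p : ℕ, p.Prime → (∀ j, padicValRat p (α j) = 0) → ∀ i, padicValRat p (θ i) = 0) := by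
  -- pass to absolute values: they are still multiplicatively independent
  have habs : ∀ j, 0 < |α j| := fun j => abs_pos.mpr (hα j)
  have hind' : ∀ μ : Fin n → ℤ, ∏ j, |α j| ^ μ j = 1 → μ = 0 := by
    intro μ hμ
    have h2 : ∏ j, α j ^ (2 * μ j) = 1 := by
      calc ∏ j, α j ^ (2 * μ j) = ∏ j, (|α j| ^ μ j) ^ 2 :=
            prod_congr rfl fun j _ => by rw [zpow_two_mul_eq, sq_zpow_abs]
        _ = (∏ j, |α j| ^ μ j) ^ 2 := prod_pow _ 2 _
        _ = 1 := by rw [hμ, one_pow]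
    have := hind _ h2
    funext j
    have hj := congr_fun this j
    simp only [Pi.zero_apply, mul_eq_zero, OfNat.ofNat_ne_zero, false_or] at hj
    exact hj
  obtain ⟨θ, hpos, hθind, hgen, hpow, hsq, h2, h3⟩ :=
    exists_kummer_basis_rat (fun j => |α j|) habs hind'
  refine ⟨θ, hpos, hθind, fun j => ?_, fun i => ?_, hsq, h2, h3, fun p hp hunit i => ?_⟩
  · obtain ⟨c, hc⟩ := hgen j
    refine ⟨c, ?_⟩
    rcases abs_choice (α j) with h | h
    · left; rw [← h]; exact hc
    · right; rw [← h]; exact hc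
  · obtain ⟨k, hk, c, hc⟩ := hpow i
    refine ⟨2 * k, mul_ne_zero two_ne_zero hk, fun j => 2 * c j, ?_⟩
    calc θ i ^ (2 * k) = (θ i ^ k) ^ 2 := zpow_two_mul_eq _ _
      _ = (∏ j, |α j| ^ c j) ^ 2 := by rw [hc]
      _ = ∏ j, (|α j| ^ c j) ^ 2 := (prod_pow _ 2 _).symm
      _ = ∏ j, α j ^ (2 * c j) :=
          prod_congr rfl fun j _ => by rw [sq_zpow_abs, zpow_two_mul_eq]
  · haveI := Fact.mk hp
    obtain ⟨k, hk, c, hc⟩ := hpow i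
    have hα' : ∀ j, |α j| ≠ 0 := fun j => (habs j).ne'
    have h1 : padicValRat p (θ i ^ k) = 0 := by
      rw [hc]
      classical
      have : ∀ s : Finset (Fin n), padicValRat p (∏ j ∈ s, |α j| ^ c j) = 0 := by
        intro s
        induction s using Finset.induction_on with
        | empty => simp
        | insert a s ha ih =>
          rw [prod_insert ha, padicValRat.mul (zpow_ne_zero _ (hα' a))
            (prod_ne_zero_iff.mpr fun j _ => zpow_ne_zero _ (hα' j)), ih, padicValRat.zpow,
            padicValRat_abs, hunit a, mul_zero, zero_add]
      exact this univ
    rw [padicValRat.zpow] at h1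
    rcases mul_eq_zero.mp h1 with h | h
    · exact absurd h hk
    · exact h


end Literature.NumberTheory.DiophantineGeometry.KummerSaturated
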